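import Summits.NavierStokesRegularity.NavierStokesRegularity.Theses.CalmSliceGate
import Summits.NavierStokesRegularity.NavierStokesRegularity.Theorems.CalmSliceGateOneSymmetricSliceStubs
import Summits.NavierStokesRegularity.NavierStokesRegularity.Theorems.CalmSliceGateOneSymmetricSliceLimit
import Summits.NavierStokesRegularity.NavierStokesRegularity.Theorems.CalmSliceGateOneSymmetricSliceAxisym
import HarnessLib

/-!
# Route `CalmSliceGate`, crux `OneSymmetricSlice` (stmt-NavierStokesRegularity-24452): CLOSED

Theorems file of route `CalmSliceGate` (seat ns-lqd-p2 g4, cell ns-idea-3). The LINE-2 converter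
`OneSymmetricSlice` — for all `C, K` there are `δ > 0`, `R > 0` such that a member of the
finite-dissipation stratum `𝒟_{C,K}` with ONE slice that is `δ`-almost axisymmetric about SOME
axis through the apex on the similarity ball `B(0, R√(−t))` is bounded on a backward parabolic
cylinder at the origin — is assembled from the five registered stubs of the planner's skeleton
(rev 2), all landed in this route's Theorems files:
`stub_symmetricLimit` (…OneSymmetricSliceLimit), `stub_isometryPullback`, `stub_rotationPullback`,
`stub_forwardMildUniqueness` (…OneSymmetricSliceStubs) and `stub_axisymTypeIExclusionStd`
(…OneSymmetricSliceAxisym, on top of the Riesz-pressure packaging …Pressure / …Distributional and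
the Seregin–Šverák barrier). Composition (the planner's, re-proved here): contradiction;
compactness gives a singular member with an EXACTLY symmetric slice about an axis `G e₃`;
pulling back by `G` puts the axis in standard position; rotating by `R_θ` and forward uniqueness
from the symmetric slice propagate axisymmetry to `[−1, 0)`; the axisymmetric exclusion then
contradicts the singularity. Navier–Stokes regularity is NOT proved by this: the wall piece
`AsymmetricFlickerLiouville` (stmt-24453) and the residual `EnstrophyQuarterLaw` (stmt-1574) stay
open; no summit is proved.
-/

noncomputable section

-- the summit and its single sub-problem share the name (CONVENTIONS §1), as in every Theorems file
set_option linter.dupNamespace false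

namespace Summit.NavierStokesRegularity.NavierStokesRegularity.Theorems

open MeasureTheory Set Filter Topology Metric Function
open Literature.Analysis Literature.Analysis.FluidPDE
open scoped ENNReal NNReal

/-- **`OneSymmetricSlice` holds** (item stmt-NavierStokesRegularity-24452 of route `CalmSliceGate`).
[cite: SereginSverak2009, Thm. 3.1 (= Thm. 1.1)] -/
theorem oneSymmetricSlice_proof :
    Summit.NavierStokesRegularity.NavierStokesRegularity.Theses.CalmSliceGate.OneSymmetricSlice := by
  unfold Summit.NavierStokesRegularity.NavierStokesRegularity.Theses.CalmSliceGate.OneSymmetricSlice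
  intro C K
  by_contra hcon
  push Not at hcon
  -- compactness: a singular member with an exactly symmetric slice at `-1` about the axis `G e₃`
  obtain ⟨W, hW, hWlaw, ⟨G, hGsym⟩, hWsing⟩ :=
    OneSymmetricSlice.Birth.stub_symmetricLimit C K hcon
  -- pull back by `G`: the axis in standard position
  obtain ⟨hV, hVlaw⟩ := OneSymmetricSlice.Birth.stub_isometryPullback C K W hW hWlaw G
  have hV1 : ∀ θ (y : EuclideanSpace ℝ (Fin 3)),
      G.symm (W (-1) (G (rotZ θ y))) = rotZ θ (G.symm (W (-1) (G y))) := by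
    intro θ y
    have h := hGsym θ (G y)
    rw [LinearIsometryEquiv.symm_apply_apply] at h
    rw [h, LinearIsometryEquiv.symm_apply_apply]
  -- forward propagation of axisymmetry on `[-1, 0)`
  have hVsym : ∀ t ∈ Set.Ico (-1 : ℝ) 0, IsAxisymmetric (fun y => G.symm (W t (G y))) := by
    intro t ht θ y
    have hVθ := OneSymmetricSlice.Birth.stub_rotationPullback C (fun t y => G.symm (W t (G y))) hV θ
    have heq : ∀ y : EuclideanSpace ℝ (Fin 3),
        G.symm (W (-1) (G y)) = rotZ (-θ) (G.symm (W (-1) (G (rotZ θ y)))) := fun y => by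
      rw [hV1, ← rotZ_add, neg_add_cancel, rotZ_zero]
    have hu := OneSymmetricSlice.Birth.stub_forwardMildUniqueness C
      (fun t y => G.symm (W t (G y))) (fun t y => rotZ (-θ) (G.symm (W t (G (rotZ θ y))))) hV hVθ
      heq t ht y
    -- `V t y = R_{-θ} V t (R_θ y)` ⇒ `V t (R_θ y) = R_θ V t y`
    show G.symm (W t (G (rotZ θ y))) = rotZ θ (G.symm (W t (G y)))
    rw [hu, ← rotZ_add, add_neg_cancel, rotZ_zero]
  -- the pulled-back field is singular (G fixes the origin and norms)
  have hVsing : ∀ r > 0, ∀ M : ℝ, ∃ t ∈ Set.Ioo (-(r ^ 2)) (0 : ℝ),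
      ∃ y ∈ Metric.ball (0 : EuclideanSpace ℝ (Fin 3)) r, M < ‖G.symm (W t (G y))‖ := by
    intro r hr M
    obtain ⟨t, ht, x, hx, hM⟩ := hWsing r hr M
    refine ⟨t, ht, G.symm x, ?_, ?_⟩
    · rwa [mem_ball_zero_iff, LinearIsometryEquiv.norm_map, ← mem_ball_zero_iff]
    · rwa [LinearIsometryEquiv.norm_map, LinearIsometryEquiv.apply_symm_apply]
  exact OneSymmetricSlice.Birth.stub_axisymTypeIExclusionStd C K (fun t y => G.symm (W t (G y)))
    hV hVlaw hVsym hVsing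

end Summit.NavierStokesRegularity.NavierStokesRegularity.Theorems

end
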